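import Literature.Analysis.FluidPDE.ChaeAsymptoticallySelfSimilarWeakLimit
import Literature.Analysis.FluidPDE.LeraySelfSimilarCalculus
import Literature.Analysis.FluidPDE.LerayHopfNSRescale
import Literature.Analysis.FluidPDE.NecasRuzickaSverakHolds
import Literature.Analysis.FluidPDE.TsaiSelfSimilarHolds
import HarnessLib

/-!
# Chae 2007, Theorem 1.5: the profile endgame `V = 0` (proofs companion, III)

Analysis/FluidPDE proofs file (theorems only: no definitions, no named facts) on the discharge
path of the named fact `Literature.Analysis.FluidPDE.chae2007_asymptoticallySelfSimilar_local`
(`ChaeAsymptoticallySelfSimilar.lean`; D. Chae, Math. Ann. 338 (2007) 435–449 =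
arXiv:math/0604234, **Theorem 1.5**). The printed proof (arXiv p. 8) obtains the first
conclusion `V̄ = 0` as: "`V̄` is a weak solution of the stationary Leray system … Since
`V̄ ∈ L^p(ℝ³)` by hypothesis, thanks to the results in [NRŠ, Tsai] (… [NRŠ] for `p = 3`, [Tsai]
for `p > 3`), we can deduce that `V̄ = 0`." The tree's Liouville theorems
`necas_ruzicka_sverak_holds` (`p = 3`) and `tsai_selfsimilar_holds` (`3 < p < ∞`) are stated for
the pointwise profile class `IsLerayProfile ν a U P` (`U ∈ C²`), so on this path the profile has
first to be regularised; this file PROVES the endgame **given a classical representative** of the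
backward self-similar field `u_V = lerayBackward ½ 0 V` on a final time interval (the form in
which the regularity theory of the tree — e.g. `mild_L3_smooth_holds` — delivers smoothness:
a classical solution agreeing with the given field slice-wise almost everywhere):

* `isLerayProfile_of_isClassical_lerayBackward` — **Leray's reduction with a free pressure**: if
  `lerayBackward a T U` (`U` smooth, `a > 0`) is, with SOME smooth pressure `p`, a classical
  solution on a time set having the normalised time `t₀ = T − (2a)⁻¹` in its interior, then
  `(U, p(t₀))` is a Leray profile (the forward half of the accepted `lerayBackward_isClassical_iff_holds`,
  which assumes the pressure in self-similar form; only the evaluation at `t₀`, where `λ = 1`, is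
  used, so the pressure need not be self-similar);
* `lerayBackward_half_zero_eq` — **change of the rate parameter**: Chae's normalisation
  `u_V(t, x) = (−t)^{-1/2} V(x/√(−t))` is Leray's field with any rate `a > 0` and profile
  `√(2a) V(√(2a) ·)` (`nsRescaleData`), whose normalised time `−(2a)⁻¹` sweeps `(−∞, 0)`;
* `profile_ae_eq_zero_of_classical_representative` — **the endgame**: if `V ∈ L^p(ℝ³)`,
  `3 ≤ p < ∞`, and some classical solution `(w, π)` (`ν > 0`, `f = 0`) on `(s₀, 0)`, `s₀ < 0`,
  satisfies `w(t) = u_V(t)` a.e. for every `t ∈ (s₀, 0)`, then `V = 0` a.e. (with `a = −1/s₀` the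
  time `s₀/2` is normalised; the smooth slice `w(s₀/2)` is a.e. the rescaled profile, `w` is then
  exactly Leray's field of that smooth profile — continuous slices a.e. equal are equal —, hence a
  Leray profile in `L^p` by the two items above, and vanishes by NRŠ / Tsai; the transfer of
  the classical solution from `w` to Leray's field is the accepted
  `IsClassicalNSSolutionOn.congr_velocity` pattern, written inline).

## References

* D. Chae, Math. Ann. 338 (2007) = arXiv:math/0604234, proof of Theorem 1.5 (arXiv p. 8) and of
  Theorem 1.4 (p. 7: the Leray system and the appeal to [NRŠ, Tsai]) [Chae2007].
* J. Nečas, M. Růžička, V. Šverák, Acta Math. 176 (1996), Thm 1 [NecasRuzickaSverak1996].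
* T.-P. Tsai, Arch. Rational Mech. Anal. 143 (1998), Thm 1 [Tsai1998].
* J. Leray, Acta Math. 63 (1934), §20, (3.11)–(3.12) [Leray1934].
-/

noncomputable section

open _root_.MeasureTheory Set Function Filter Metric TopologicalSpace InnerProductSpace
open scoped NNReal ENNReal _root_.Topology RealInnerProductSpace Laplacian ContDiff

namespace Literature.Analysis.FluidPDE

section General

variable {E : Type*} [NormedAddCommGroup E] [InnerProductSpace ℝ E] [FiniteDimensional ℝ E]

/-- **Leray's reduction with a free pressure** (Leray 1934, §20, (3.11)–(3.12); the forward half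
of the accepted `lerayBackward_isClassical_iff_holds` without the self-similar form of the
pressure). If the backward self-similar field `u = lerayBackward a T U` of a smooth profile `U`,
`a > 0`, is — together with SOME smooth pressure `p` — a classical solution of Navier–Stokes
(viscosity `ν`, no force) on a time set `S` containing the normalised time `t₀ = T − (2a)⁻¹` in its
interior, then `(U, p(t₀))` is a Leray profile: at `t₀` the scale factor is `λ = 1`, `u(t₀) = U`,
`∂ₜu(t₀) = a(U + (y·∇)U)` (`timeDeriv_lerayBackward`), and the momentum equation at `t₀` is the
profile equation with pressure `p(t₀)`. [cite: Leray1934, §20 (3.11)–(3.12) p. 225] -/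
theorem isLerayProfile_of_isClassical_lerayBackward {ν a T : ℝ} (ha : 0 < a) {U : E → E}
    {p : ℝ → E → ℝ} (hU : ContDiff ℝ ∞ U) {S : Set ℝ} (hS : T - (2 * a)⁻¹ ∈ interior S)
    (h : IsClassicalNSSolutionOn S ν 0 (lerayBackward a T U) p) :
    IsLerayProfile ν a U (p (T - (2 * a)⁻¹)) := by
  have hU1 : ContDiff ℝ 1 U := hU.of_le (by norm_cast)
  have ht₀ : T - (2 * a)⁻¹ < T := sub_lt_self T (inv_pos.2 (by positivity))
  have hmem : T - (2 * a)⁻¹ ∈ S := interior_subset hS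
  have hu₀ : lerayBackward a T U (T - (2 * a)⁻¹) = U := lerayBackward_apply_sub_inv ha T U
  refine ⟨hU.of_le (by norm_cast), (h.contDiff_pressure hmem).of_le (by norm_cast), fun y => ?_,
    fun y => ?_⟩
  · have hm := h.momentum _ hmem y
    rw [timeDerivWithin_of_mem_interior hS y, timeDeriv_lerayBackward ha ht₀ hU1 y,
      lerayScale_sub_inv ha T, hu₀] at hm
    simp only [one_pow, mul_one, one_smul, smul_add, Pi.zero_apply, add_zero] at hm
    calc -(ν • (Δ U) y) + a • U y + a • fderiv ℝ U y y + convect U U y +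
          gradient (p (T - (2 * a)⁻¹)) y
        = (a • U y + a • fderiv ℝ U y y + convect U U y) -
            (ν • (Δ U) y - gradient (p (T - (2 * a)⁻¹)) y) := by abel
      _ = 0 := by rw [hm, sub_self]
  · have hd := h.divFree _ hmem y
    rwa [hu₀] at hd

omit [FiniteDimensional ℝ E] in
/-- **Change of the rate parameter.** Chae's normalisation `u_V = lerayBackward ½ 0 V`
(`u_V(t, x) = (−t)^{-1/2} V(x/√(−t))`, Chae 2007, (3.13)) is Leray's backward field with ANY
rate `a > 0` and the rescaled profile `nsRescaleData √(2a) V = √(2a) V(√(2a) ·)`: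
`(2a(−t))^{-1/2} √(2a) V(√(2a) (2a(−t))^{-1/2} x) = (−t)^{-1/2} V(x/√(−t))` for `t < 0` (and both
sides are the junk value for `t ≥ 0`). [cite: Chae2007, (3.13) (arXiv p. 8)] -/
theorem lerayBackward_half_zero_eq (V : E → E) {a : ℝ} (ha : 0 < a) :
    lerayBackward (1 / 2) 0 V = lerayBackward a 0 (nsRescaleData (Real.sqrt (2 * a)) V) := by
  funext t x
  have h2a : 0 < 2 * a := by positivity
  set c : ℝ := Real.sqrt (2 * a) with hc
  have hc0 : c ≠ 0 := (Real.sqrt_pos.2 h2a).ne'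
  rcases lt_or_ge t 0 with ht | ht
  · have hnt : 0 < -t := neg_pos.2 ht
    set s : ℝ := Real.sqrt (-t) with hs
    have hs0 : s ≠ 0 := (Real.sqrt_pos.2 hnt).ne'
    have e1 : Real.sqrt (2 * (1 / 2) * (0 - t)) = s := by rw [hs]; norm_num
    have e2 : Real.sqrt (2 * a * (0 - t)) = c * s := by rw [zero_sub, Real.sqrt_mul h2a.le]
    rw [lerayBackward_apply, lerayBackward_apply, e1, e2]
    show s⁻¹ • V (s⁻¹ • x) = (c * s)⁻¹ • (c • V (c • ((c * s)⁻¹ • x)))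
    have k1 : (c * s)⁻¹ * c = s⁻¹ := by field_simp
    have k2 : c * (c * s)⁻¹ = s⁻¹ := by field_simp
    rw [smul_smul, smul_smul, k1, k2]
  · -- junk region `t ≥ 0`: both scale factors vanish
    have e1 : Real.sqrt (2 * (1 / 2) * (0 - t)) = 0 := Real.sqrt_eq_zero'.2 (by linarith)
    have e2 : Real.sqrt (2 * a * (0 - t)) = 0 := Real.sqrt_eq_zero'.2 (by nlinarith)
    rw [lerayBackward_apply, lerayBackward_apply, e1, e2]
    simp [nsRescaleData]

end General



section Endgame

/-- **Chae 2007, proof of Theorem 1.5, first conclusion — the endgame** (arXiv p. 8: "`V̄` is a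
weak solution of the stationary Leray system … `V̄ ∈ L^p(ℝ³)` … [NRŠ] for `p = 3`, [Tsai] for
`p > 3` … `V̄ = 0`"), given a classical representative. Let `V ∈ L^p(ℝ³)`, `3 ≤ p < ∞`, and suppose
the backward self-similar field `u_V = lerayBackward ½ 0 V` has, on some final time interval
`(s₀, 0)`, `s₀ < 0`, a classical representative: a classical solution `(w, π)` of Navier–Stokes
(`ν > 0`, `f = 0`) on `(s₀, 0)` with `w(t) = u_V(t)` a.e. for every `t ∈ (s₀, 0)`. Then `V = 0`
a.e. Proof: with the rate `a = −1/s₀` the time `t₁ = s₀/2` is normalised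
(`lerayBackward_half_zero_eq`), so `w(t₁)` is a.e. the rescaled profile `Uₐ = √(2a)V(√(2a)·)`;
`w` is then exactly Leray's field of the smooth profile `U = w(t₁)` (continuous slices a.e. equal
are equal), `(U, π(t₁))` is a Leray profile (`isLerayProfile_of_isClassical_lerayBackward`) with
`U ∈ L^p`, so `U = 0` by `necas_ruzicka_sverak_holds` (`p = 3`) / `tsai_selfsimilar_holds`
(`p > 3`), whence `Uₐ = 0` a.e. and `V = 0` a.e. [cite: Chae2007, proof of Thm 1.5 (arXiv p. 8)] -/
theorem profile_ae_eq_zero_of_classical_representative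
    {V : EuclideanSpace ℝ (Fin 3) → EuclideanSpace ℝ (Fin 3)} {p : ℝ≥0∞} (hp3 : 3 ≤ p)
    (hptop : p < (⊤ : ℝ≥0∞)) (hV : MemLp V p volume) {s₀ ν : ℝ} (hs₀ : s₀ < 0) (hν : 0 < ν)
    {w : ℝ → EuclideanSpace ℝ (Fin 3) → EuclideanSpace ℝ (Fin 3)}
    {π : ℝ → EuclideanSpace ℝ (Fin 3) → ℝ} (hw : IsClassicalNSSolutionOn (Ioo s₀ 0) ν 0 w π)
    (hae : ∀ t ∈ Ioo s₀ 0, w t =ᵐ[volume] lerayBackward (1 / 2) 0 V t) :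
    V =ᵐ[volume] 0 := by
  -- the rate `a = -1/s₀` normalises the time `t₁ = s₀/2`
  set a : ℝ := -s₀⁻¹ with ha
  have ha0 : 0 < a := by rw [ha]; exact neg_pos.2 (inv_lt_zero.2 hs₀)
  have ht₁ : (0 : ℝ) - (2 * a)⁻¹ = s₀ / 2 := by rw [ha]; field_simp; ring
  have ht₁mem : s₀ / 2 ∈ Ioo s₀ 0 := ⟨by linarith, by linarith⟩
  have hint : (0 : ℝ) - (2 * a)⁻¹ ∈ interior (Ioo s₀ 0) := by rw [interior_Ioo, ht₁]; exact ht₁mem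
  set c : ℝ := Real.sqrt (2 * a) with hc
  have hc0 : c ≠ 0 := (Real.sqrt_pos.2 (by positivity)).ne'
  set Ua : EuclideanSpace ℝ (Fin 3) → EuclideanSpace ℝ (Fin 3) := nsRescaleData c V with hUa
  have huV : lerayBackward (1 / 2) 0 V = lerayBackward a 0 Ua := lerayBackward_half_zero_eq V ha0
  -- the smooth slice at `t₁`
  set U : EuclideanSpace ℝ (Fin 3) → EuclideanSpace ℝ (Fin 3) := w (s₀ / 2) with hU
  have hUsmooth : ContDiff ℝ ∞ U := hw.contDiff_velocity ht₁mem
  have hUae : Ua =ᵐ[volume] U := by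
    have h1 := hae _ ht₁mem
    have e : lerayBackward a 0 Ua (s₀ / 2) = Ua := by
      rw [← ht₁]; exact lerayBackward_apply_sub_inv ha0 0 Ua
    rw [huV, e] at h1
    exact h1.symm
  -- `w` IS the self-similar field of the smooth profile `U`
  have hwt : ∀ t ∈ Ioo s₀ 0, w t = lerayBackward a 0 U t := by
    intro t ht
    have hlt : t < 0 := ht.2
    set l : ℝ := (Real.sqrt (2 * a * (0 - t)))⁻¹ with hl
    have hl0 : l ≠ 0 := (inv_pos.2 (Real.sqrt_pos.2 (by nlinarith))).ne'
    have h1 : w t =ᵐ[volume] lerayBackward a 0 Ua t := huV ▸ hae t ht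
    have h2 : lerayBackward a 0 Ua t =ᵐ[volume] lerayBackward a 0 U t := by
      have hcomp := (Measure.quasiMeasurePreserving_smul volume hl0).ae_eq_comp hUae
      filter_upwards [hcomp] with x hx
      simp only [Function.comp_apply] at hx
      simp only [lerayBackward_apply, ← hl, hx]
    have hcw : Continuous (w t) := (hw.contDiff_velocity ht).continuous
    have hUc : Continuous U := hUsmooth.continuous
    have hcu : Continuous (lerayBackward a 0 U t) := by
      show Continuous fun x =>
        (Real.sqrt (2 * a * (0 - t)))⁻¹ • U ((Real.sqrt (2 * a * (0 - t)))⁻¹ • x)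
      fun_prop
    exact (Continuous.ae_eq_iff_eq volume hcw hcu).1 (h1.trans h2)
  have hw' : IsClassicalNSSolutionOn (Ioo s₀ 0) ν 0 (lerayBackward a 0 U) π :=
    { smooth_velocity := hw.smooth_velocity.congr fun q hq => by
        change lerayBackward a 0 U q.1 q.2 = w q.1 q.2
        rw [hwt q.1 (mem_prod.1 hq).1]
      smooth_pressure := hw.smooth_pressure
      momentum := fun t ht x => by
        have h1 : timeDerivWithin (Ioo s₀ 0) (lerayBackward a 0 U) t x =
            timeDerivWithin (Ioo s₀ 0) w t x := by
          simp only [timeDerivWithin]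
          exact derivWithin_congr (fun s hs => by rw [hwt s hs]) (by rw [hwt t ht])
        rw [h1, ← hwt t ht]
        exact hw.momentum t ht x
      divFree := fun t ht => by
        rw [← hwt t ht]
        exact hw.divFree t ht }
  -- Leray's reduction with the free pressure `π`
  have hprof : IsLerayProfile ν a U (π (0 - (2 * a)⁻¹)) :=
    isLerayProfile_of_isClassical_lerayBackward ha0 hUsmooth hint hw'
  -- `U ∈ L^p`
  have hUp : MemLp U p volume := (memLp_nsRescaleData hV hc0).ae_eq hUae
  -- Liouville: `U = 0`
  have hU0 : U = 0 := by
    rcases hp3.eq_or_lt with h3 | h3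
    · exact necas_ruzicka_sverak_holds hν ha0 hprof (h3 ▸ hUp)
    · exact tsai_selfsimilar_holds hν ha0 hprof h3 hptop hUp
  -- back to `V`
  have hUa0 : Ua =ᵐ[volume] 0 := hU0 ▸ hUae
  have hVc : (fun x => V (c • x)) =ᵐ[volume] 0 := by
    filter_upwards [hUa0] with x hx
    have hx' : c • V (c • x) = 0 := hx
    exact (smul_eq_zero.1 hx').resolve_left hc0
  have hcomp := (Measure.quasiMeasurePreserving_smul volume (inv_ne_zero hc0)).ae_eq_comp hVc
  filter_upwards [hcomp] with x hx
  simpa only [Function.comp_apply, smul_smul, mul_inv_cancel₀ hc0, one_smul, Pi.zero_apply] using hx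

end Endgame

end Literature.Analysis.FluidPDE

end
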